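import Summits.ResolutionOfSingularities.ResolutionOfSingularities.Theorems.FrobeniusClosingPatchingRelPerfectDepthMultiHostFormatSnc
import Literature.AlgebraicGeometry.Resolution.SncSaturatedCentre
import HarnessLib

/-!
# Crux `PatchingRelPerfect` (stmt-ResolutionOfSingularities-16161), chain W5.2 — F7(β) (β-AX) spec v4.3 A8: the RESIDUAL CURRENCY
# `K = M · K♭` of a multi-host state (`MultiHostState.residual`)

[OURS · L1 W5.2 · F7(β) (β-AX) · res-L1-w52-plan-1 RULING G11-25 (ARCHITECTURE AMENDMENT A8/A9, 2026-08-27T17:00:33Z) «Define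
`MultiHostState.residual` := the same state with `exps i ↦ exps i − μ` where `μ(T) := min_i exps_i(T)` (member-wise minimum over the
summands), so that `S.K = monomialIdeal (S.𝓔.map fun T => (T, μ T)) * S.residual.K` («K = M · K♭»); `residual` has the SAME 𝓔 / n / host,
so `S.IsFormatSncOn U 𝓒 𝓗 ↔ S.residual.IsFormatSncOn U 𝓒 𝓗` is `Iff.rfl`-level, and E1 (p546954) + T4 (p543632) are applied VERBATIM to
`S.residual` under the hypothesis `cosupp S.residual.K ⊆ U`; T5 multiplies back: `M.comap s.comp` is locally principal (monomial in members =
effective Cartier on regular X, pulled back) and a product of locally principal ideals is locally principal»; OBJECT named for res-D-repro-1 AS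
res-L1-repro-3 (custody res-plan-2 DEAL #33 (A)).]  Replaces the role of NO printed item; NOT a statement of the manuscript under review
(AI-written, weaker than expert review).  ONE definition block (`minExpAt` / `minExps` / `residualExps` / `residual`, review lane) + lemmas;
Mathlib + the W5.2 format files only; no fact, no sorry.

## Contents
* `MultiHostState.minExpAt S j` — `μ_j := ⨅_i (exps i)_j` the member-wise minimum exponent at position `j` of `𝓔` (`0` when `n = 0`);
  `MultiHostState.minExps S` — the exponent list `M = [(T_j, μ_j)]_j` on `𝓔`; `MultiHostState.residualExps S i` — `exps i − μ` position-wise;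
  **`MultiHostState.residual S`** — the state `⟨𝓔, n, host, residualExps, snc, _⟩` (same members, same hosts).
* rfl-lemmas `residual_𝓔`, `residual_n`, `residual_host`, `residual_exps`; `boundaryOf_minExps`, `boundaryOf_residualExps`;
  `minExpAt_le` (`μ_j ≤ (exps i)_j`).
* **`K_eq_monomial_mul_residual`** — `S.K = monomialIdeal S.minExps * S.residual.K` («K = M · K♭»), from the position-wise factor law
  `monomialIdeal_eq_mul_of_le` (`∏ T_j^{e_j} = ∏ T_j^{μ_j} · ∏ T_j^{e_j − μ_j}` for `μ ≤ e` position-wise) and `mul_iSup` on ideal sheaves.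
* `K_le_residual_K` — `K ≤ K♭` (`M ≤ ⊤`).
* **`isFormatSncOn_residual_iff`** — `S.residual.IsFormatSncOn U 𝓒 𝓗 ↔ S.IsFormatSncOn U 𝓒 𝓗` (`Iff.rfl`: the predicate reads `𝓔`, `n`,
  `host` only).
* **`residual_K_support_subset`** — `cosupp K♭ ⊆ cosupp K` (`support (M · K♭) = support M ∪ support K♭`); so `cosupp S.K ⊆ U ⇒ cosupp
  S.residual.K ⊆ U` (`residual_K_support_subset_of`), the hypothesis under which E1/T4 are applied to `S.residual`.
* **`isEffectiveCartier_monomialIdeal_minExps`** (members of an snc family are effective Cartier, `HasSNCWith.isEffectiveCartier_of_mem`;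
  a monomial in them is, `DepthGraded.isEffectiveCartier_monomialIdeal`), **`isLocallyPrincipal_comap_K_of_residual`** — T5's multiply-back:
  for any `f : X′ ⟶ X`, `IsLocallyPrincipal (S.residual.K.comap f) → IsLocallyPrincipal (S.K.comap f)` (`comap_mul`, `IsLocallyPrincipal.comap/.mul`).

## References
* E. Bierstone, D. Grigoriev, P. Milman, J. Włodarczyk, *Effective Hironaka resolution and its complexity*, Asian J. Math. 15 (2011), §4 Step 2b
  (the monomial part `𝓜(𝓘)` of a marked ideal and its residual). [BierstoneGrigorievMilmanWlodarczyk2011]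
* J. Kollár, *Lectures on Resolution of Singularities* (2007), (3.111) Step 3 (`I = 𝒪(−Σ aⱼEʲ)·Ĩ`, monomial bookkeeping). [Kollar2007]
-/

-- `Summit.<Summit>.<Sub>.Theorems` with `Sub = Summit` (single-conjunct summit, D-0017)
set_option linter.dupNamespace false

noncomputable section

open CategoryTheory AlgebraicGeometry TopologicalSpace
open Literature.AlgebraicGeometry.Resolution
open Scheme.IdealSheafData

namespace Summit.ResolutionOfSingularities.ResolutionOfSingularities.Theorems.DepthMultiHost

universe u

variable {X X' : Scheme.{u}}

/-! ## §0 Exponent-list bookkeeping: position-wise operations and the factor law -/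

section Lists

/-- Position-wise re-exponentiation keeps the boundary. [folklore] -/
theorem boundaryOf_mapIdx (E : List (X.IdealSheafData × ℕ)) (g : ℕ → X.IdealSheafData × ℕ → ℕ) :
    boundaryOf (E.mapIdx fun j p => (p.1, g j p)) = boundaryOf E := by
  induction E generalizing g with
  | nil => simp [boundaryOf]
  | cons p E ih =>
    rw [List.mapIdx_cons]
    exact congrArg (List.cons p.1) (ih fun i => g (i + 1))

/-- Position-wise re-exponentiation only depends on the boundary. [folklore] -/
theorem mapIdx_eq_of_boundaryOf (E : List (X.IdealSheafData × ℕ)) (μ : ℕ → ℕ) :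
    (E.mapIdx fun j p => (p.1, μ j)) = (boundaryOf E).mapIdx fun j T => (T, μ j) := by
  induction E generalizing μ with
  | nil => simp [boundaryOf]
  | cons p E ih =>
    change ((p :: E).mapIdx fun j q => (q.1, μ j)) = (p.1 :: boundaryOf E).mapIdx fun j T => (T, μ j)
    rw [List.mapIdx_cons, List.mapIdx_cons]
    exact congrArg (List.cons (p.1, μ 0)) (ih fun i => μ (i + 1))

/-- A list re-paired position-wise with new exponents has the original list as boundary. [folklore] -/
theorem map_fst_mapIdx_pair (L : List X.IdealSheafData) (μ : ℕ → ℕ) :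
    boundaryOf (L.mapIdx fun j T => (T, μ j)) = L := by
  induction L generalizing μ with
  | nil => simp [boundaryOf]
  | cons T L ih =>
    rw [List.mapIdx_cons]
    exact congrArg (List.cons T) (ih fun i => μ (i + 1))

/-- **Multiplication distributes over suprema of ideal sheaves.** [folklore] -/
theorem mul_iSup_idealSheafData (I : X.IdealSheafData) {ι : Type*} (J : ι → X.IdealSheafData) :
    I * (⨆ i, J i) = ⨆ i, I * J i := by
  apply Scheme.IdealSheafData.ext
  funext U
  simp only [ideal_mul, ideal_iSup, Pi.mul_apply, iSup_apply, Ideal.mul_iSup]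

/-- **The position-wise FACTOR LAW**: for exponents `μ_j ≤ e_j` at every position, `∏ T_j^{e_j} = ∏ T_j^{μ_j} · ∏ T_j^{e_j − μ_j}`.
[cite: Kollar2007, (3.111) Step 3] -/
theorem monomialIdeal_eq_mul_of_le (E : List (X.IdealSheafData × ℕ)) (μ : ℕ → ℕ)
    (hμ : ∀ j : ℕ, μ j ≤ (E.map Prod.snd).getD j 0) :
    monomialIdeal E = monomialIdeal (E.mapIdx fun j p => (p.1, μ j)) * monomialIdeal (E.mapIdx fun j p => (p.1, p.2 - μ j)) := by
  induction E generalizing μ with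
  | nil => simp
  | cons p E ih =>
    have h0 : μ 0 ≤ p.2 := by simpa using hμ 0
    have ih' := ih (fun j => μ (j + 1)) fun j => by simpa using hμ (j + 1)
    simp only [List.mapIdx_cons, monomialIdeal_cons]
    rw [ih', show p.1 ^ p.2 = p.1 ^ μ 0 * p.1 ^ (p.2 - μ 0) by rw [← pow_add, Nat.add_sub_cancel' h0]]
    exact mul_mul_mul_comm _ _ _ _

end Lists

namespace MultiHostState

variable (S : MultiHostState X)

/-! ## §1 The residual state -/

/-- [OURS · L1 W5.2 · A8] **The exponent of summand `i` at position `j` of the member family** (`0` past the end). [folklore] -/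
def expAt (i : Fin S.n) (j : ℕ) : ℕ :=
  ((S.exps i).map Prod.snd).getD j 0

/-- [OURS · L1 W5.2 · A8] **`μ_j := min_i (exps i)_j`**, the member-wise minimum exponent over all summands (`0` when there is no summand).
[cite: BierstoneGrigorievMilmanWlodarczyk2011, §4 Step 2b] -/
def minExpAt (j : ℕ) : ℕ :=
  ⨅ i : Fin S.n, S.expAt i j

/-- [OURS · L1 W5.2 · A8] **The monomial part `M = [(T_j, μ_j)]_j`** of the state, an exponent list on `𝓔`.
[cite: BierstoneGrigorievMilmanWlodarczyk2011, §4 Step 2b] [cite: Kollar2007, (3.111) Step 3] -/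
def minExps : List (X.IdealSheafData × ℕ) :=
  S.𝓔.mapIdx fun j T => (T, S.minExpAt j)

/-- [OURS · L1 W5.2 · A8] **The residual exponent list of summand `i`**: `(exps i)_j − μ_j` at every position `j`. [folklore] -/
def residualExps (i : Fin S.n) : List (X.IdealSheafData × ℕ) :=
  (S.exps i).mapIdx fun j p => (p.1, p.2 - S.minExpAt j)

/-- The residual exponent lists live on `𝓔`. [folklore] -/
theorem boundaryOf_residualExps (i : Fin S.n) : boundaryOf (S.residualExps i) = S.𝓔 := by
  rw [residualExps, boundaryOf_mapIdx]
  exact S.boundaryOf_exps i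

/-- [OURS · L1 W5.2 · F7(β) (β-AX) spec v4.3 A8 · res-L1-w52-plan-1 RULING G11-25] **THE RESIDUAL STATE `S♭`**: the same members, the same
hosts, the exponent lists divided by their member-wise minimum — so that `K = M · K♭` (`K_eq_monomial_mul_residual`).
[cite: BierstoneGrigorievMilmanWlodarczyk2011, §4 Step 2b] [cite: Kollar2007, (3.111) Step 3] -/
def residual : MultiHostState X where
  𝓔 := S.𝓔
  n := S.n
  host := S.host
  exps := S.residualExps
  snc := S.snc
  boundaryOf_exps := S.boundaryOf_residualExps

/-- The residual has the same members. [folklore] -/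
@[simp] theorem residual_𝓔 : S.residual.𝓔 = S.𝓔 := rfl

/-- The residual has the same number of summands. [folklore] -/
@[simp] theorem residual_n : S.residual.n = S.n := rfl

/-- The residual has the same hosts. [folklore] -/
@[simp] theorem residual_host (i : Fin S.n) : S.residual.host i = S.host i := rfl

/-- The residual's exponent lists. [folklore] -/
@[simp] theorem residual_exps (i : Fin S.n) : S.residual.exps i = S.residualExps i := rfl

/-- The monomial part lives on `𝓔`. [folklore] -/
theorem boundaryOf_minExps : boundaryOf S.minExps = S.𝓔 :=
  map_fst_mapIdx_pair S.𝓔 S.minExpAt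

/-- `μ_j ≤ (exps i)_j`. [folklore] -/
theorem minExpAt_le (i : Fin S.n) (j : ℕ) : S.minExpAt j ≤ S.expAt i j :=
  ciInf_le (OrderBot.bddBelow _) i

/-! ## §2 `K = M · K♭` -/

/-- Each summand's monomial factors through the monomial part. [cite: Kollar2007, (3.111) Step 3] -/
theorem monomialIdeal_exps_eq (i : Fin S.n) :
    monomialIdeal (S.exps i) = monomialIdeal S.minExps * monomialIdeal (S.residualExps i) := by
  have h := monomialIdeal_eq_mul_of_le (S.exps i) S.minExpAt fun j => S.minExpAt_le i j
  rw [mapIdx_eq_of_boundaryOf, S.boundaryOf_exps i] at h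
  exact h

/-- [OURS · L1 W5.2 · A8] **`K = M · K♭`**: `S.K = monomialIdeal S.minExps * S.residual.K`.
[cite: BierstoneGrigorievMilmanWlodarczyk2011, §4 Step 2b] [cite: Kollar2007, (3.111) Step 3] -/
theorem K_eq_monomial_mul_residual : S.K = monomialIdeal S.minExps * S.residual.K := by
  unfold K
  rw [mul_iSup_idealSheafData]
  refine iSup_congr fun i => ?_
  change S.host i * monomialIdeal (S.exps i) = monomialIdeal S.minExps * (S.host i * monomialIdeal (S.residualExps i))
  rw [S.monomialIdeal_exps_eq i, mul_left_comm]

/-- [OURS · L1 W5.2 · A8] **`K ≤ K♭`** (`M ≤ ⊤`; res-D-pv-021 SHAPE REVIEW 17:10:48Z: the form a pole-side reader wants). [folklore] -/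
theorem K_le_residual_K : S.K ≤ S.residual.K := by
  rw [S.K_eq_monomial_mul_residual]
  exact mul_le_of_le_one_left bot_le le_top

/-! ## §3 Format-snc END and cosupports -/

/-- [OURS · L1 W5.2 · A8] **Format-snc END does not see the exponents**: `S♭` is format-snc END on `U` iff `S` is (same `𝓒`, same `𝓗`).
[folklore] -/
theorem isFormatSncOn_residual_iff (U : X.Opens) (𝓒 : List X.IdealSheafData) (𝓗 : Fin S.n → List (X.IdealSheafData × ℕ)) :
    S.residual.IsFormatSncOn U 𝓒 𝓗 ↔ S.IsFormatSncOn U 𝓒 𝓗 :=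
  Iff.rfl

/-- [OURS · L1 W5.2 · A8] **`cosupp K♭ ⊆ cosupp K`**. [folklore] -/
theorem residual_K_support_subset : (S.residual.K.support : Set X) ⊆ (S.K.support : Set X) := by
  intro x hx
  rw [S.K_eq_monomial_mul_residual, support_mul, TopologicalSpace.Closeds.coe_sup]
  exact Or.inr hx

/-- Hence a cosupport bound for `K` is one for `K♭`. [folklore] -/
theorem residual_K_support_subset_of {U : X.Opens} (hU : (S.K.support : Set X) ⊆ (U : Set X)) :
    (S.residual.K.support : Set X) ⊆ (U : Set X) :=
  fun _ hx => hU (S.residual_K_support_subset hx)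

/-! ## §4 T5's multiply-back: the monomial part is effective Cartier, so local principality lifts from `K♭` to `K` -/

/-- [OURS · L1 W5.2 · A8] **The monomial part is an effective Cartier divisor** (members of an snc family are effective Cartier; a monomial
in them is). [cite: BierstoneGrigorievMilmanWlodarczyk2011, Def. 3.1.1] [cite: Kollar2007, (3.111) Step 3] -/
theorem isEffectiveCartier_monomialIdeal_minExps [IsLocallyNoetherian X] : IsEffectiveCartier (monomialIdeal S.minExps) :=
  DepthGraded.isEffectiveCartier_monomialIdeal fun G hG =>
    HasSNCWith.isEffectiveCartier_of_mem S.snc (by rwa [S.boundaryOf_minExps] at hG)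

/-- [OURS · L1 W5.2 · A8/T5] **Multiply back**: along any morphism `f : X′ ⟶ X`, if `K♭` pulls back to a locally principal ideal then so does
`K = M · K♭` (`M` pulls back to a locally principal ideal; products of locally principal ideals are locally principal). [folklore] -/
theorem isLocallyPrincipal_comap_K_of_residual [IsLocallyNoetherian X] (f : X' ⟶ X)
    (h : IsLocallyPrincipal (S.residual.K.comap f)) : IsLocallyPrincipal (S.K.comap f) := by
  rw [S.K_eq_monomial_mul_residual, comap_mul]
  exact (S.isEffectiveCartier_monomialIdeal_minExps.isLocallyPrincipal.comap f).mul h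

end MultiHostState

end Summit.ResolutionOfSingularities.ResolutionOfSingularities.Theorems.DepthMultiHost

end
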